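import Literature.NumberTheory.Automorphic.AutomorphicSpectrum
import HarnessLib

/-!
# Transport of the `L²` automorphic spectrum along an equivariant, measure-preserving isomorphism of automorphic quotients

Topic `NumberTheory/Automorphic`; namespace `Literature.NumberTheory.Automorphic` (the generic representation-theoretic layer is a
dot-notation extension of `ContRepresentation.ClosedSubrep`, as in ★ `AutomorphicGaloisConj`).  DEFINITIONS (concrete constructions,
no `Prop` shell, no named fact) + THEOREMS; no instance, no notation, no `sorry`.

THE POINT.  ★ `AutomorphicGaloisConj` transports closed subrepresentations of `L²` of ONE automorphic quotient along an isomorphism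
that is equivariant up to an AUTOMORPHISM `θ : G ≃* G` of ONE group (`IsConjEquivariant`, `mapConj`, `galL2Equiv`).  Comparing an
inner form with its quasi-split model (`U(H) ≃ U(Φ₃)` over the base field when `H` is similar to `Φ₃`), or any two adelic group data
`𝒢`, `𝒢′` identified by an ISOMORPHISM `e : G(𝔸) ≃* G′(𝔸)` carrying `A_G · G(K)` onto `A_{G′} · G′(K)`, needs the HETERO version:
two groups, two quotients, two measures.  Given
* `e : 𝒢.Adelic ≃* 𝒢'.Adelic`,
* a measurable isomorphism `Φ : 𝒢.automorphicQuotient ≃ᵐ 𝒢'.automorphicQuotient` (e.g. `Homeomorph.toMeasurableEquiv` of the quotient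
  homeomorphism induced by a bicontinuous `e`) which is `e`-EQUIVARIANT, `Φ (g • x) = e g • Φ x`, and
* MEASURE PRESERVING, `MeasurePreserving Φ μ μ'` (i.e. `Measure.map Φ μ = μ'`),
the composition `U_Φ f := f ∘ Φ⁻¹` is a linear isometric isomorphism `L²(μ) ≃ L²(μ′)` with `U_Φ ∘ R(g) = R′(e g) ∘ U_Φ`, so it carries
closed invariant subspaces to closed invariant subspaces, preserves irreducibility, and maps a discrete automorphic representation `P`
of `𝒢` to one of `𝒢′` whose underlying representation is `P ∘ e⁻¹` (Borel–Jacquet (1979) §4.6: the spaces `L²(G(K) A_G \ G(𝔸))` and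
their decomposition are functorial in isomorphisms of the pair `(G(𝔸), G(K) A_G)`).

* §1 (generic, any `ContRepresentation`s `π` of `G` on `V` and `π′` of `G′` on `V′`) the INLINE hypothesis
  `∀ g v, e (π g v) = π' (θ g) (e v)` (`e : V ≃L V'`, `θ : G ≃* G'`; no new predicate), `mapAlong`, `mapAlongEquiv`, `mapAlongOrderIso`, irreducibility
  and fixed vectors under transport — the `θ : G ≃* G'` twin of ★ `IsConjEquivariant` ∕ `mapConj` (same proofs).
* §2 `quotL2 Φ hΦ : 𝒢.L2 μ →ₗᵢ[ℂ] 𝒢'.L2 μ'`, `quotL2Equiv`, the a.e. formula, and **`quotL2_rightRegular`**: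
  `U_Φ (R(g) f) = R′(e g) (U_Φ f)`; `quotL2Equiv_rightRegular`.
* §3 `DiscreteAutomorphicRep.mapAlong` (the transported discrete automorphic representation, space `U_Φ(P)`), its membership lemma and
  the equivariant isomorphism `P.space ≃L P′.space`.
* The hook for LOCAL CONSTITUENTS (restriction along compatible embeddings `ι : H →* G(𝔸)`, `ι′ : H′ →* G′(𝔸)`, `θ : H ≃ₜ* H′`,
  smooth vectors correspond) is the sibling file `SmoothVectorsAlongGroupIso` (pure representation theory, no measure).

What is NOT here: the construction of `e`, `Φ` for a concrete pair (e.g. a rational similitude of hermitian forms) and the proof that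
the push-forward of an automorphic measure is THE automorphic measure of `𝒢′` (uniqueness up to scalar + total mass); consumers supply
`hΦ : MeasurePreserving Φ μ μ'` (for `μ' := Measure.map Φ μ` it is `Φ.measurable.measurePreserving`-trivial).

## References
* [BorelJacquet1979] A. Borel, H. Jacquet, *Automorphic forms and automorphic representations*, Proc. Sympos. Pure Math. 33 (1979),
  part 1, §4.6.
* [PlatonovRapinchuk1994] V. Platonov, A. Rapinchuk, *Algebraic Groups and Number Theory* (1994), §2.3 (forms and similitudes), Ch. 5.
-/

noncomputable section

open MeasureTheory Topology
open scoped ENNReal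

/-! ## §1 Closed subrepresentations along an isomorphism equivariant for a group ISOMORPHISM `θ : G ≃* G'` (generic) -/

namespace ContRepresentation.ClosedSubrep

section MapAlong

variable {k G G' V V' : Type*} [CommRing k] [Group G] [Group G']
  [AddCommGroup V] [TopologicalSpace V] [IsTopologicalAddGroup V] [Module k V]
  [AddCommGroup V'] [TopologicalSpace V'] [IsTopologicalAddGroup V'] [Module k V']
  {π : ContRepresentation k G V} {π' : ContRepresentation k G' V'}

/-! A topological linear isomorphism `e : V ≃L V'` is EQUIVARIANT ALONG the group isomorphism `θ : G ≃* G'` from `π` (a representation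
of `G`) to `π'` (a representation of `G'`) when `∀ g v, e (π g v) = π' (θ g) (e v)` — an equivalence `π ≅ π' ∘ θ`; this hypothesis `he`
(kept INLINE, no new predicate) is the `θ : G ≃* G'` twin of ★ `IsConjEquivariant` (there `G' = G`). -/

variable {e : V ≃L[k] V'} {θ : G ≃* G'}

/-- The inverse of an isomorphism equivariant along `θ` is equivariant along `θ⁻¹`. [cite: Dixmier1977, §13.1] -/
theorem semiconj_symm_of_semiconj (he : ∀ g v, e (π g v) = π' (θ g) (e v)) (g' : G') (v' : V') :
    e.symm (π' g' v') = π (θ.symm g') (e.symm v') := by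
  apply e.injective
  rw [e.apply_symm_apply, he, e.apply_symm_apply, MulEquiv.apply_symm_apply]

/-- **Transport of a closed subrepresentation along an equivariant isomorphism**: the image `e(W)` of a closed `π`-invariant subspace is
a closed `π'`-invariant subspace (`π'(g') e(w) = e(π(θ⁻¹ g') w)`).  Twin of ★ `mapConj`. [cite: BorelJacquet1979, §4.6] -/
def mapAlong (W : ClosedSubrep π) (he : ∀ g v, e (π g v) = π' (θ g) (e v)) : ClosedSubrep π' where
  toSubmodule := W.toSubmodule.map (e : V →ₗ[k] V')
  apply_mem_toSubmodule g' := by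
    rintro _ ⟨v, hv, rfl⟩
    refine ⟨π (θ.symm g') v, W.apply_mem _ hv, ?_⟩
    change e (π (θ.symm g') v) = π' g' (e v)
    rw [he, MulEquiv.apply_symm_apply]
  isClosed' := by
    change IsClosed ((W.toSubmodule.map (e : V →ₗ[k] V') : Submodule k V') : Set V')
    rw [Submodule.map_coe]
    exact e.isClosed_image.mpr W.isClosed

/-- The submodule underlying `W.mapAlong he` is the image `e(W)` (definitional). [cite: Dixmier1977, §13.1] -/
@[simp]
theorem toSubmodule_mapAlong (W : ClosedSubrep π) (he : ∀ g v, e (π g v) = π' (θ g) (e v)) :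
    (W.mapAlong he).toSubmodule = W.toSubmodule.map (e : V →ₗ[k] V') := rfl

/-- `v' ∈ e(W) ↔ e⁻¹ v' ∈ W`. [cite: Dixmier1977, §13.1] -/
theorem mem_mapAlong_iff (W : ClosedSubrep π) (he : ∀ g v, e (π g v) = π' (θ g) (e v)) {v' : V'} :
    v' ∈ W.mapAlong he ↔ e.symm v' ∈ W := by
  change v' ∈ W.toSubmodule.map (e : V →ₗ[k] V') ↔ _
  constructor
  · rintro ⟨v, hv, rfl⟩
    change e.symm (e v) ∈ W
    rwa [e.symm_apply_apply]
  · intro h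
    exact ⟨e.symm v', h, e.apply_symm_apply v'⟩

/-- `e w ∈ e(W)` for `w ∈ W`. [cite: Dixmier1977, §13.1] -/
theorem apply_mem_mapAlong (W : ClosedSubrep π) (he : ∀ g v, e (π g v) = π' (θ g) (e v)) {v : V} (hv : v ∈ W) : e v ∈ W.mapAlong he :=
  (W.mem_mapAlong_iff he).mpr (by rwa [e.symm_apply_apply])

/-- `e w ∈ e(W) ↔ w ∈ W`. [cite: Dixmier1977, §13.1] -/
theorem apply_mem_mapAlong_iff (W : ClosedSubrep π) (he : ∀ g v, e (π g v) = π' (θ g) (e v)) {v : V} : e v ∈ W.mapAlong he ↔ v ∈ W := by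
  rw [mem_mapAlong_iff, e.symm_apply_apply]

/-- `e⁻¹(e(W)) = W`. [cite: Dixmier1977, §13.1] -/
theorem mapAlong_mapAlong_symm (W : ClosedSubrep π) (he : ∀ g v, e (π g v) = π' (θ g) (e v)) : (W.mapAlong he).mapAlong (semiconj_symm_of_semiconj he) = W := by
  ext v
  rw [mem_mapAlong_iff, mem_mapAlong_iff, e.symm_symm, e.symm_apply_apply]

/-- `e(e⁻¹(W')) = W'`. [cite: Dixmier1977, §13.1] -/
theorem mapAlong_symm_mapAlong (W' : ClosedSubrep π') (he : ∀ g v, e (π g v) = π' (θ g) (e v)) : (W'.mapAlong (semiconj_symm_of_semiconj he)).mapAlong he = W' := by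
  ext v
  rw [mem_mapAlong_iff, mem_mapAlong_iff, e.symm_symm, e.apply_symm_apply]

/-- `e(W₁) ≤ e(W₂) ↔ W₁ ≤ W₂`. [cite: Dixmier1977, §13.1] -/
theorem mapAlong_le_mapAlong_iff {W₁ W₂ : ClosedSubrep π} (he : ∀ g v, e (π g v) = π' (θ g) (e v)) :
    W₁.mapAlong he ≤ W₂.mapAlong he ↔ W₁ ≤ W₂ := by
  constructor
  · intro h v hv
    have := h (W₁.apply_mem_mapAlong he hv)
    rwa [apply_mem_mapAlong_iff] at this
  · intro h v' hv'
    rw [mem_mapAlong_iff] at hv' ⊢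
    exact h hv'

/-- `e(W₁) = e(W₂) ↔ W₁ = W₂`. [cite: Dixmier1977, §13.1] -/
theorem mapAlong_inj {W₁ W₂ : ClosedSubrep π} (he : ∀ g v, e (π g v) = π' (θ g) (e v)) : W₁.mapAlong he = W₂.mapAlong he ↔ W₁ = W₂ := by
  simp only [le_antisymm_iff, mapAlong_le_mapAlong_iff he]

/-- Transport along an equivariant isomorphism is an **order isomorphism** between the lattices of closed subrepresentations of `π` and
of `π'`. [cite: Dixmier1977, §13.1] -/
def mapAlongOrderIso (he : ∀ g v, e (π g v) = π' (θ g) (e v)) : ClosedSubrep π ≃o ClosedSubrep π' where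
  toFun W := W.mapAlong he
  invFun W' := W'.mapAlong (semiconj_symm_of_semiconj he)
  left_inv W := W.mapAlong_mapAlong_symm he
  right_inv W' := W'.mapAlong_symm_mapAlong he
  map_rel_iff' := mapAlong_le_mapAlong_iff he

/-- **Topological irreducibility is invariant under equivariant isomorphisms** (`π ≅ π' ∘ θ`). [cite: BorelJacquet1979, §4.6] -/
theorem isTopIrreducible_iff_of_semiconj [T1Space V] [T1Space V'] (he : ∀ g v, e (π g v) = π' (θ g) (e v)) :
    π.IsTopIrreducible ↔ π'.IsTopIrreducible :=
  (mapAlongOrderIso he).isSimpleOrder_iff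

/-- The isomorphism `W ≃L e(W)` induced by `e`. [cite: Dixmier1977, §13.1] -/
def mapAlongEquiv (W : ClosedSubrep π) (he : ∀ g v, e (π g v) = π' (θ g) (e v)) : W.toSubmodule ≃L[k] (W.mapAlong he).toSubmodule where
  toLinearEquiv :=
    { toFun := fun w => ⟨e (w : V), W.apply_mem_mapAlong he w.2⟩
      map_add' := fun w w' => Subtype.ext (map_add e (w : V) (w' : V))
      map_smul' := fun c w => Subtype.ext (map_smul e c (w : V))
      invFun := fun w' => ⟨e.symm (w' : V'), (W.mem_mapAlong_iff he).mp w'.2⟩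
      left_inv := fun w => Subtype.ext (e.symm_apply_apply w)
      right_inv := fun w' => Subtype.ext (e.apply_symm_apply w') }
  continuous_toFun := (e.continuous.comp continuous_subtype_val).subtype_mk _
  continuous_invFun := (e.symm.continuous.comp continuous_subtype_val).subtype_mk _

/-- `mapAlongEquiv w = e w` in `V'`. [cite: Dixmier1977, §13.1] -/
@[simp]
theorem coe_mapAlongEquiv_apply (W : ClosedSubrep π) (he : ∀ g v, e (π g v) = π' (θ g) (e v)) (w : W.toSubmodule) :
    (W.mapAlongEquiv he w : V') = e w := rfl

/-- `(mapAlongEquiv)⁻¹ w' = e⁻¹ w'` in `V`. [cite: Dixmier1977, §13.1] -/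
@[simp]
theorem coe_mapAlongEquiv_symm_apply (W : ClosedSubrep π) (he : ∀ g v, e (π g v) = π' (θ g) (e v)) (w' : (W.mapAlong he).toSubmodule) :
    ((W.mapAlongEquiv he).symm w' : V) = e.symm w' := rfl

/-- `mapAlongEquiv` is equivariant along `θ` between the representations on `W` and on `e(W)`. [cite: BorelJacquet1979, §4.6] -/
theorem mapAlongEquiv_toContRep_apply (W : ClosedSubrep π) (he : ∀ g v, e (π g v) = π' (θ g) (e v)) (g : G) (w : W.toSubmodule) :
    W.mapAlongEquiv he (W.toContRep g w) = (W.mapAlong he).toContRep (θ g) (W.mapAlongEquiv he w) :=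
  Subtype.ext (he g w)

/-- **`e(W)` is irreducible iff `W` is.** [cite: BorelJacquet1979, §4.6] -/
theorem isTopIrreducible_mapAlong_iff [T1Space V] [T1Space V'] (W : ClosedSubrep π) (he : ∀ g v, e (π g v) = π' (θ g) (e v)) :
    (W.mapAlong he).toContRep.IsTopIrreducible ↔ W.toContRep.IsTopIrreducible :=
  (isTopIrreducible_iff_of_semiconj (W.mapAlongEquiv_toContRep_apply he)).symm

/-- Fixed vectors correspond: `e w` is `θ(Kf)`-fixed iff `w` is `Kf`-fixed. [cite: BorelJacquet1979, §4.6] -/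
theorem mapAlongEquiv_mem_fixedVectors_iff (W : ClosedSubrep π) (he : ∀ g v, e (π g v) = π' (θ g) (e v)) (Kf : Subgroup G)
    (w : W.toSubmodule) :
    W.mapAlongEquiv he w ∈ (W.mapAlong he).fixedVectors (Kf.map θ.toMonoidHom) ↔ w ∈ W.fixedVectors Kf := by
  rw [mem_fixedVectors, mem_fixedVectors]
  constructor
  · intro h x hx
    have := h (θ x) ⟨x, hx, rfl⟩
    rw [← W.mapAlongEquiv_toContRep_apply he x w] at this
    exact (W.mapAlongEquiv he).injective this
  · rintro h _ ⟨x, hx, rfl⟩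
    change (W.mapAlong he).toContRep (θ x) (W.mapAlongEquiv he w) = _
    rw [← W.mapAlongEquiv_toContRep_apply he x w, h x hx]

end MapAlong

end ContRepresentation.ClosedSubrep

namespace Literature.NumberTheory.Automorphic

/-! ## §2 `U_Φ : L²(μ) ≃ L²(μ′)` along a measure-preserving isomorphism of automorphic quotients, and the regular representations -/

section L2

open AdelicGroupData

variable {K : Type} [Field K] [NumberField K] {𝒢 𝒢' : AdelicGroupData K}
  {μ : Measure 𝒢.automorphicQuotient} {μ' : Measure 𝒢'.automorphicQuotient}
  (Φ : 𝒢.automorphicQuotient ≃ᵐ 𝒢'.automorphicQuotient) (hΦ : MeasurePreserving Φ μ μ')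

/-- **`U_Φ : L²(G(𝔸) ⧸ A_G G(K), μ) → L²(G′(𝔸) ⧸ A_{G′} G′(K), μ′)`, `U_Φ f = f ∘ Φ⁻¹`** — a linear isometry for a measure-preserving
measurable isomorphism `Φ` of the automorphic quotients (Mathlib `Lp.compMeasurePreservingₗᵢ` along `Φ.symm`).
[cite: BorelJacquet1979, §4.6] -/
def quotL2 : 𝒢.L2 μ →ₗᵢ[ℂ] 𝒢'.L2 μ' :=
  Lp.compMeasurePreservingₗᵢ ℂ (Φ.symm : 𝒢'.automorphicQuotient → 𝒢.automorphicQuotient) (MeasurePreserving.symm Φ hΦ)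

/-- The a.e. formula `(U_Φ f)(y) = f (Φ⁻¹ y)`. [cite: BorelJacquet1979, §4.6] -/
theorem quotL2_coeFn (f : 𝒢.L2 μ) : (quotL2 Φ hΦ f : 𝒢'.automorphicQuotient → ℂ) =ᵐ[μ'] fun y => f (Φ.symm y) :=
  Lp.coeFn_compMeasurePreserving f (MeasurePreserving.symm Φ hΦ)

/-- `U_Φ` on the class of a function: `U_Φ [φ] = [φ ∘ Φ⁻¹]`. [cite: BorelJacquet1979, §4.6] -/
theorem quotL2_toLp {φ : 𝒢.automorphicQuotient → ℂ} (hφ : MemLp φ 2 μ) :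
    quotL2 Φ hΦ (hφ.toLp φ) = (hφ.comp_measurePreserving (MeasurePreserving.symm Φ hΦ)).toLp (fun y => φ (Φ.symm y)) :=
  Lp.toLp_compMeasurePreserving hφ (MeasurePreserving.symm Φ hΦ)

/-- `U_Φ` preserves the norm. [cite: BorelJacquet1979, §4.6] -/
theorem norm_quotL2 (f : 𝒢.L2 μ) : ‖quotL2 Φ hΦ f‖ = ‖f‖ :=
  (quotL2 Φ hΦ).norm_map f

/-- `Lp.compMeasurePreserving` only depends on the function, not on the measure-preservation proof (two maps `α → β`). [folklore] -/
private theorem Lp.compMeasurePreserving_congr_fun₂ {α β : Type*} [MeasurableSpace α] [MeasurableSpace β] {μa : Measure α} {μb : Measure β}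
    {f₁ f₂ : α → β} (h : f₁ = f₂) (h₁ : MeasurePreserving f₁ μa μb) (h₂ : MeasurePreserving f₂ μa μb) (g : Lp ℂ 2 μb) :
    Lp.compMeasurePreserving f₁ h₁ g = Lp.compMeasurePreserving f₂ h₂ g := by
  subst h; rfl

/-- `U_{Φ⁻¹} (U_Φ f) = f`. [cite: BorelJacquet1979, §4.6] -/
theorem quotL2_symm_quotL2 (f : 𝒢.L2 μ) : quotL2 Φ.symm (MeasurePreserving.symm Φ hΦ) (quotL2 Φ hΦ f) = f := by
  have hΦs : MeasurePreserving Φ.symm μ' μ := MeasurePreserving.symm Φ hΦ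
  have hΦss : MeasurePreserving Φ.symm.symm μ μ' := MeasurePreserving.symm Φ.symm hΦs
  have hid : ((Φ.symm : 𝒢'.automorphicQuotient → 𝒢.automorphicQuotient) ∘ (Φ.symm.symm : 𝒢.automorphicQuotient → 𝒢'.automorphicQuotient)) = id :=
    funext fun x => by simp only [Function.comp_apply, MeasurableEquiv.symm_symm, MeasurableEquiv.symm_apply_apply, id_eq]
  change Lp.compMeasurePreserving _ hΦss (Lp.compMeasurePreserving _ hΦs f) = f
  rw [← Lp.compMeasurePreserving_comp_apply f hΦs hΦss,
    Lp.compMeasurePreserving_congr_fun₂ hid (hΦs.comp hΦss) (MeasurePreserving.id μ) f, Lp.compMeasurePreserving_id_apply]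

/-- `U_Φ (U_{Φ⁻¹} f') = f'` (`Φ⁻¹⁻¹ = Φ` definitionally). [cite: BorelJacquet1979, §4.6] -/
theorem quotL2_quotL2_symm (f' : 𝒢'.L2 μ') : quotL2 Φ hΦ (quotL2 Φ.symm (MeasurePreserving.symm Φ hΦ) f') = f' :=
  quotL2_symm_quotL2 Φ.symm (MeasurePreserving.symm Φ hΦ) f'

/-- **`U_Φ` as a linear isometric EQUIVALENCE `L²(μ) ≃ L²(μ′)`** (inverse `U_{Φ⁻¹}`). [cite: BorelJacquet1979, §4.6] -/
def quotL2Equiv : 𝒢.L2 μ ≃ₗᵢ[ℂ] 𝒢'.L2 μ' where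
  toLinearEquiv :=
    { (quotL2 Φ hΦ).toLinearMap with
      invFun := quotL2 Φ.symm (MeasurePreserving.symm Φ hΦ)
      left_inv := quotL2_symm_quotL2 Φ hΦ
      right_inv := quotL2_quotL2_symm Φ hΦ }
  norm_map' := norm_quotL2 Φ hΦ

/-- `quotL2Equiv` is `quotL2` as a function (definitional). [cite: BorelJacquet1979, §4.6] -/
@[simp] theorem coe_quotL2Equiv : ⇑(quotL2Equiv Φ hΦ) = quotL2 Φ hΦ := rfl

/-- The inverse of `quotL2Equiv Φ` is `quotL2 Φ⁻¹`. [cite: BorelJacquet1979, §4.6] -/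
@[simp] theorem quotL2Equiv_symm_apply (f' : 𝒢'.L2 μ') :
    (quotL2Equiv Φ hΦ).symm f' = quotL2 Φ.symm (MeasurePreserving.symm Φ hΦ) f' := rfl

variable {Φ}

/-- An `e`-equivariant isomorphism of quotients has an `e⁻¹`-equivariant inverse: `Φ⁻¹ (g' • y) = e⁻¹ g' • Φ⁻¹ y`. [cite: BorelJacquet1979, §4.6] -/
theorem quotEquiv_symm_apply_smul (e : 𝒢.Adelic ≃* 𝒢'.Adelic) (hΦe : ∀ (g : 𝒢.Adelic) (x : 𝒢.automorphicQuotient), Φ (g • x) = e g • Φ x)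
    (g' : 𝒢'.Adelic) (y : 𝒢'.automorphicQuotient) : Φ.symm (g' • y) = e.symm g' • Φ.symm y := by
  apply Φ.injective
  rw [MeasurableEquiv.apply_symm_apply, hΦe, MulEquiv.apply_symm_apply, MeasurableEquiv.apply_symm_apply]

/-- In particular `Φ⁻¹ ((e g)⁻¹ • y) = g⁻¹ • Φ⁻¹ y`. [cite: BorelJacquet1979, §4.6] -/
theorem quotEquiv_symm_apply_inv_smul (e : 𝒢.Adelic ≃* 𝒢'.Adelic) (hΦe : ∀ (g : 𝒢.Adelic) (x : 𝒢.automorphicQuotient), Φ (g • x) = e g • Φ x)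
    (g : 𝒢.Adelic) (y : 𝒢'.automorphicQuotient) : Φ.symm ((e g)⁻¹ • y) = g⁻¹ • Φ.symm y := by
  rw [quotEquiv_symm_apply_smul e hΦe, ← map_inv e, MulEquiv.symm_apply_apply]

variable (Φ)
variable [SMulInvariantMeasure 𝒢.Adelic 𝒢.automorphicQuotient μ] [SMulInvariantMeasure 𝒢'.Adelic 𝒢'.automorphicQuotient μ']

/-- **The intertwining relation `U_Φ R(g) = R′(e g) U_Φ`** between `U_Φ` and the regular representations of `G(𝔸)` on `L²(μ)` and of
`G′(𝔸)` on `L²(μ′)`, for `Φ` equivariant along `e : G(𝔸) ≃* G′(𝔸)`: on `U_Φ(W)` the element `e g` acts as `g` acts on `W`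
(`U_Φ(W) ≅ W ∘ e⁻¹`).  Twin of ★ `galL2_rightRegular`. [cite: BorelJacquet1979, §4.6] -/
theorem quotL2_rightRegular (e : 𝒢.Adelic ≃* 𝒢'.Adelic)
    (hΦe : ∀ (g : 𝒢.Adelic) (x : 𝒢.automorphicQuotient), Φ (g • x) = e g • Φ x) (g : 𝒢.Adelic) (f : 𝒢.L2 μ) :
    quotL2 Φ hΦ (𝒢.rightRegular μ g f) = 𝒢'.rightRegular μ' (e g) (quotL2 Φ hΦ f) := by
  apply Lp.ext
  have hΦs : MeasurePreserving Φ.symm μ' μ := MeasurePreserving.symm Φ hΦ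
  have h1 := quotL2_coeFn Φ hΦ (𝒢.rightRegular μ g f)
  have h2 : (fun y => ((𝒢.rightRegular μ g f : 𝒢.L2 μ) : 𝒢.automorphicQuotient → ℂ) (Φ.symm y)) =ᵐ[μ']
      fun y => f (g⁻¹ • Φ.symm y) := by
    have h0 : ((𝒢.rightRegular μ g f : 𝒢.L2 μ) : 𝒢.automorphicQuotient → ℂ)
        =ᵐ[μ'.map (Φ.symm : 𝒢'.automorphicQuotient → 𝒢.automorphicQuotient)] fun x => f (g⁻¹ • x) := by
      rw [hΦs.map_eq]; exact 𝒢.rightRegular_apply_coeFn μ g f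
    exact ae_eq_comp hΦs.measurable.aemeasurable h0
  have h3 := 𝒢'.rightRegular_apply_coeFn μ' (e g) (quotL2 Φ hΦ f)
  have h4 : (fun y => (quotL2 Φ hΦ f : 𝒢'.automorphicQuotient → ℂ) ((e g)⁻¹ • y)) =ᵐ[μ'] fun y => f (Φ.symm ((e g)⁻¹ • y)) := by
    have h0 : (quotL2 Φ hΦ f : 𝒢'.automorphicQuotient → ℂ)
        =ᵐ[μ'.map fun y : 𝒢'.automorphicQuotient => (e g)⁻¹ • y] fun y => f (Φ.symm y) := by
      rw [(measurePreserving_smul ((e g)⁻¹) μ').map_eq]; exact quotL2_coeFn Φ hΦ f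
    exact ae_eq_comp (measurable_const_smul ((e g)⁻¹)).aemeasurable h0
  have h5 : (fun y => (f : 𝒢.automorphicQuotient → ℂ) (g⁻¹ • Φ.symm y)) = fun y => f (Φ.symm ((e g)⁻¹ • y)) := by
    funext y
    rw [quotEquiv_symm_apply_inv_smul e hΦe]
  exact h1.trans (h2.trans ((Filter.EventuallyEq.of_eq h5).trans (h3.trans h4).symm))

/-- `U_Φ`, as a topological linear isomorphism, is equivariant along `e` for the regular representations (the inline hypothesis `he` of §1).
[cite: BorelJacquet1979, §4.6] -/
theorem quotL2Equiv_rightRegular (e : 𝒢.Adelic ≃* 𝒢'.Adelic)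
    (hΦe : ∀ (g : 𝒢.Adelic) (x : 𝒢.automorphicQuotient), Φ (g • x) = e g • Φ x) (g : 𝒢.Adelic) (f : 𝒢.L2 μ) :
    (quotL2Equiv Φ hΦ : 𝒢.L2 μ ≃L[ℂ] 𝒢'.L2 μ') (𝒢.rightRegular μ g f) =
      𝒢'.rightRegular μ' (e g) ((quotL2Equiv Φ hΦ : 𝒢.L2 μ ≃L[ℂ] 𝒢'.L2 μ') f) :=
  quotL2_rightRegular Φ hΦ e hΦe g f

/-! ## §3 Transport of closed subrepresentations of `L²` and of discrete automorphic representations -/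

/-- **The transported closed subrepresentation `U_Φ(W) ≤ L²(μ′)`** of the regular representation of `G′(𝔸)`, for `W ≤ L²(μ)` a closed
subrepresentation of the regular representation of `G(𝔸)`; as a representation `U_Φ(W) ≅ W ∘ e⁻¹`. [cite: BorelJacquet1979, §4.6] -/
def _root_.ContRepresentation.ClosedSubrep.quotMapAlong (W : ContRepresentation.ClosedSubrep (𝒢.rightRegular μ))
    (e : 𝒢.Adelic ≃* 𝒢'.Adelic) (hΦe : ∀ (g : 𝒢.Adelic) (x : 𝒢.automorphicQuotient), Φ (g • x) = e g • Φ x) :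
    ContRepresentation.ClosedSubrep (𝒢'.rightRegular μ') :=
  W.mapAlong (quotL2Equiv_rightRegular Φ hΦ e hΦe)

/-- Membership in `U_Φ(W)`: `f' ∈ U_Φ(W) ↔ U_{Φ⁻¹} f' ∈ W`. [cite: BorelJacquet1979, §4.6] -/
theorem _root_.ContRepresentation.ClosedSubrep.mem_quotMapAlong_iff (W : ContRepresentation.ClosedSubrep (𝒢.rightRegular μ))
    (e : 𝒢.Adelic ≃* 𝒢'.Adelic) (hΦe : ∀ (g : 𝒢.Adelic) (x : 𝒢.automorphicQuotient), Φ (g • x) = e g • Φ x) {f' : 𝒢'.L2 μ'} :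
    f' ∈ W.quotMapAlong Φ hΦ e hΦe ↔ quotL2 Φ.symm (MeasurePreserving.symm Φ hΦ) f' ∈ W :=
  W.mem_mapAlong_iff _

/-- `U_Φ f ∈ U_Φ(W) ↔ f ∈ W`. [cite: BorelJacquet1979, §4.6] -/
theorem _root_.ContRepresentation.ClosedSubrep.quotL2_mem_quotMapAlong_iff (W : ContRepresentation.ClosedSubrep (𝒢.rightRegular μ))
    (e : 𝒢.Adelic ≃* 𝒢'.Adelic) (hΦe : ∀ (g : 𝒢.Adelic) (x : 𝒢.automorphicQuotient), Φ (g • x) = e g • Φ x) {f : 𝒢.L2 μ} :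
    quotL2 Φ hΦ f ∈ W.quotMapAlong Φ hΦ e hΦe ↔ f ∈ W :=
  W.apply_mem_mapAlong_iff _

/-- **`U_Φ(W)` is irreducible iff `W` is.** [cite: BorelJacquet1979, §4.6] -/
theorem _root_.ContRepresentation.ClosedSubrep.isTopIrreducible_quotMapAlong_iff
    (W : ContRepresentation.ClosedSubrep (𝒢.rightRegular μ))
    (e : 𝒢.Adelic ≃* 𝒢'.Adelic) (hΦe : ∀ (g : 𝒢.Adelic) (x : 𝒢.automorphicQuotient), Φ (g • x) = e g • Φ x) :
    (W.quotMapAlong Φ hΦ e hΦe).toContRep.IsTopIrreducible ↔ W.toContRep.IsTopIrreducible :=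
  W.isTopIrreducible_mapAlong_iff _

/-- **The transported discrete automorphic representation** `P ∘ e⁻¹` of `𝒢′`: space `U_Φ(P)`, irreducible because `P` is.
[cite: BorelJacquet1979, §4.6] -/
def _root_.Literature.NumberTheory.Automorphic.DiscreteAutomorphicRep.mapAlong (P : DiscreteAutomorphicRep 𝒢 μ)
    (e : 𝒢.Adelic ≃* 𝒢'.Adelic) (hΦe : ∀ (g : 𝒢.Adelic) (x : 𝒢.automorphicQuotient), Φ (g • x) = e g • Φ x) :
    DiscreteAutomorphicRep 𝒢' μ' where
  space := P.space.quotMapAlong Φ hΦ e hΦe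
  irreducible := (P.space.isTopIrreducible_quotMapAlong_iff Φ hΦ e hΦe).2 P.irreducible

/-- The space of the transported representation is `U_Φ(P)` (definitional). [cite: BorelJacquet1979, §4.6] -/
@[simp] theorem DiscreteAutomorphicRep.mapAlong_space (P : DiscreteAutomorphicRep 𝒢 μ)
    (e : 𝒢.Adelic ≃* 𝒢'.Adelic) (hΦe : ∀ (g : 𝒢.Adelic) (x : 𝒢.automorphicQuotient), Φ (g • x) = e g • Φ x) :
    (P.mapAlong Φ hΦ e hΦe).space = P.space.quotMapAlong Φ hΦ e hΦe := rfl

/-- **The equivariant isomorphism `P ≃L P ∘ e⁻¹`** on underlying spaces: `w ↦ U_Φ w`, with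
`U_Φ (P(g) w) = (P ∘ e⁻¹)(e g) (U_Φ w)`. [cite: BorelJacquet1979, §4.6] -/
theorem DiscreteAutomorphicRep.mapAlongEquiv_toContRep_apply (P : DiscreteAutomorphicRep 𝒢 μ)
    (e : 𝒢.Adelic ≃* 𝒢'.Adelic) (hΦe : ∀ (g : 𝒢.Adelic) (x : 𝒢.automorphicQuotient), Φ (g • x) = e g • Φ x)
    (g : 𝒢.Adelic) (w : P.space.toSubmodule) :
    P.space.mapAlongEquiv (quotL2Equiv_rightRegular Φ hΦ e hΦe) (P.space.toContRep g w) =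
      (P.mapAlong Φ hΦ e hΦe).space.toContRep (e g) (P.space.mapAlongEquiv (quotL2Equiv_rightRegular Φ hΦ e hΦe) w) :=
  P.space.mapAlongEquiv_toContRep_apply _ g w

/-- Round trip: transporting `P` along `(Φ, e)` and back along `(Φ⁻¹, e⁻¹)` returns `P`'s space. [cite: BorelJacquet1979, §4.6] -/
theorem DiscreteAutomorphicRep.mapAlong_mapAlong_symm_space (P : DiscreteAutomorphicRep 𝒢 μ)
    (e : 𝒢.Adelic ≃* 𝒢'.Adelic) (hΦe : ∀ (g : 𝒢.Adelic) (x : 𝒢.automorphicQuotient), Φ (g • x) = e g • Φ x)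
    (hΦe' : ∀ (g' : 𝒢'.Adelic) (y : 𝒢'.automorphicQuotient), Φ.symm (g' • y) = e.symm g' • Φ.symm y) :
    ((P.mapAlong Φ hΦ e hΦe).mapAlong Φ.symm (MeasurePreserving.symm Φ hΦ) e.symm hΦe').space = P.space := by
  ext f
  rw [DiscreteAutomorphicRep.mapAlong_space, ContRepresentation.ClosedSubrep.mem_quotMapAlong_iff,
    DiscreteAutomorphicRep.mapAlong_space, ContRepresentation.ClosedSubrep.mem_quotMapAlong_iff]
  -- `Φ.symm.symm = Φ` definitionally, so the inner map is `U_Φ` and `U_{Φ⁻¹} ∘ U_Φ = id`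
  change quotL2 Φ.symm (MeasurePreserving.symm Φ hΦ) (quotL2 Φ hΦ f) ∈ P.space ↔ f ∈ P.space
  rw [quotL2_symm_quotL2]

end L2


end Literature.NumberTheory.Automorphic

end
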